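import Mathlib
import HarnessLib
import Literature.Probability.Percolation.MinOpenCut
import Literature.Probability.Percolation.SharpnessDCTProofs
import Literature.Probability.Percolation.LatticeSymmetry
import Literature.Probability.Percolation.RSW
import Summits.CriticalPhenomena.PercolationContinuityZ3.Theorems.QuantitativeBGN.Negative.ArmLowerBound

/-!
# `stub_ceiling` of line `Sketch` (crux `BudgetTightness`, stmt-CriticalPhenomena-5248):
# the level-cutset ceiling `E_p[S(L, h+1)] ≤ (L+1)² · P_p(armH h)`

Registered stub of the lead's skeleton `Cruxes/BudgetTightness/Lines/Sketch.lean`. For every `p`, `L`,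
`h`, the expected bottom-to-top min-cut budget `S(L, h+1)` of the slab piece
`Q(L, h+1) = [0, L]² × [0, h+1]` of `ℤ³` is at most `(L+1)²` times the half-space one-arm probability
`P_p(armH h)`, `armH h = {∃ y, ‖y‖∞ ≥ h ∧ 0 ↔ y in ℍ}`, `ℍ = {x | 0 ≤ x 0}`
(`Theorems.QuantitativeBGN.Negative.armH`, written out in the statement). This is the slab form of
the level cutset of Zhang (2000) / Rossignol–Théret (2018, Prop. 3.9).

* CUTSET (`toNat_minOpenCutIn_le_sum_indicator`, deterministic, lattice configurations
  `ω ⊆ E(ℤ³)`): let `U = Q ∩ {1 ≤ z}` and call a vertex `v` *joined* if `v ↔ top in U`. An open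
  bottom-to-top walk inside `Q` starts at a non-joined vertex (the bottom layer misses `U`) and ends
  at a joined one, so it has an open dart `(a, b)` with `a` not joined, `b` joined
  (`SimpleGraph.Walk.exists_boundary_dart`); `a ∈ U` would make `a` joined through the open edge, so
  `a` lies on the bottom layer, `b = a + e₂` lies on the layer `{z = 1}`, and the edge is one of the
  vertical edges `T(ω) = {s(v - e₂, v) : v ∈ layer 1, v joined}`. Hence `T(ω)` is an open cutset and
  `S(L, h+1)(ω) ≤ #T(ω) ≤ Σ_{v ∈ layer 1} 𝟙{v joined}`.
* EXPECTATION (`integral_toNat_minOpenCutIn_le_sum`): integrate the a.s. bound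
  (`setBernoulli_ae_subset`, `integral_mono_of_nonneg`, `integral_indicator_one`).
* SYMMETRY (`real_setOf_joined_le`): for `v` on layer `1` the lattice automorphism `faceIso v 2 1`
  (translate `v` to `0`, swap the vertical axis with the `0`-th one) maps `U` into `ℍ` and the top
  layer to `{x₀ = h}`, so `P_p(v joined) ≤ P_p(armH h)` (`relabel_mem_openConnIn`, `openConnIn_mono`,
  `bondPercolation_real_preimage_relabel_iso`); the layer has `(L+1)²` vertices.

## References

* R. Rossignol, M. Théret, *Existence and continuity of the flow constant in first passage
  percolation*, Electron. J. Probab. 23 (2018), Prop. 3.9 [RossignolTheret2018].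
* Y. Zhang, *Critical behavior for maximal flows on the cubic lattice*, J. Stat. Phys. 98 (2000)
  [Zhang2000].
-/

noncomputable section

namespace Summit.CriticalPhenomena.PercolationContinuityZ3.Theorems.BudgetTightness

open MeasureTheory ProbabilityTheory
open Literature.Probability.Percolation Literature.Probability.LatticeModels
open Summit.CriticalPhenomena.PercolationContinuityZ3.Theorems.QuantitativeBGN.Negative
  (armH faceIso faceIso_apply_zero faceIso_apply_self)

namespace StubCeiling

/-! ### The level cutset (any vertex type) -/

section General

variable {V : Type*}

/-- **The level cutset** (deterministic, for configurations on the graph `G`). Let `U ⊇ top` be a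
region missing `bot`, and suppose every `G`-edge `a ∼ b` with `a ∈ Q ∖ U`, `b ∈ U` has `a = f b` and
`b ∈ Lay`. Call `v` *joined* if `v ↔ top` inside `U`. Then the edges `s(f v, v)`, `v ∈ Lay` joined,
form an open cutset of `(Q, bot, top)`: an open walk inside `Q` from `bot` (not joined) to `top`
(joined) has an open dart from a non-joined `a` to a joined `b`; `a ∈ U` would be joined through
that edge, so `a = f b`, `b ∈ Lay`. Hence `MinCut_Q(bot, top)(ω) ≤ Σ_{v ∈ Lay} 𝟙{v joined}(ω)`. -/
theorem toNat_minOpenCutIn_le_sum_indicator {G : SimpleGraph V} {Q bot top U : Set V}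
    {Lay : Finset V} (f : V → V) (hbot : ∀ x ∈ bot, x ∉ U) (htop : top ⊆ U)
    (hstep : ∀ a ∈ Q, a ∉ U → ∀ b ∈ U, G.Adj a b → a = f b ∧ b ∈ Lay)
    {ω : BondConfig V} (hω : ω ⊆ G.edgeSet) :
    ((minOpenCutIn Q bot top ω).toNat : ℝ) ≤
      ∑ v ∈ Lay, {ω' : BondConfig V | ∃ t ∈ top, ω' ∈ openConnIn U v t}.indicator
        (1 : BondConfig V → ℝ) ω := by
  classical
  -- `W v`: `v` is joined to `top` inside `U`
  let W : V → Prop := fun v => ∃ t ∈ top, ω ∈ openConnIn U v t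
  set T : Finset (Sym2 V) := (Lay.filter fun v => W v).image fun v => s(f v, v) with hT
  have hcut : IsOpenCutsetIn Q bot top ω ↑T := by
    rintro x hx y hy ⟨hxS, hyS, ⟨p⟩⟩
    set WS : Set ↥Q := {z | ¬ W z.1} with hWS
    have hxP : (⟨x, hxS⟩ : ↥Q) ∈ WS := by
      rintro ⟨t, -, hxU, -, -⟩
      exact hbot x hx hxU
    have hyP : (⟨y, hyS⟩ : ↥Q) ∉ WS := fun h' =>
      h' ⟨y, hy, htop hy, htop hy, SimpleGraph.Reachable.refl _⟩
    obtain ⟨d, -, hd1, hd2⟩ := p.exists_boundary_dart WS hxP hyP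
    have hadj := d.adj
    rw [SimpleGraph.induce_adj, openGraph_adj] at hadj
    obtain ⟨⟨hωd, hdT⟩, hne⟩ := hadj
    have hWb : W d.snd.1 := not_not.1 hd2
    obtain ⟨t, ht, hbU, htU, hreach⟩ := hWb
    have hGadj : G.Adj d.fst.1 d.snd.1 := hω hωd
    -- `a ∉ U`, else `a` would be joined through the open edge `s(a, b)`
    have haU : d.fst.1 ∉ U := by
      intro haU
      refine hd1 ⟨t, ht, haU, htU, ?_⟩
      refine SimpleGraph.Reachable.trans (SimpleGraph.Adj.reachable ?_) hreach
      rw [SimpleGraph.induce_adj, openGraph_adj]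
      exact ⟨hωd, hne⟩
    obtain ⟨hab, hbL⟩ := hstep d.fst.1 d.fst.2 haU d.snd.1 hbU hGadj
    refine hdT (Finset.mem_coe.2 (Finset.mem_image.2 ⟨d.snd.1,
      Finset.mem_filter.2 ⟨hbL, t, ht, hbU, htU, hreach⟩, ?_⟩))
    rw [← hab]
  calc ((minOpenCutIn Q bot top ω).toNat : ℝ) ≤ ((Lay.filter fun v => W v).card : ℝ) := by
        have h1 : minOpenCutIn Q bot top ω ≤ T.card := minOpenCutIn_le_card hcut
        have h2 : T.card ≤ (Lay.filter fun v => W v).card := Finset.card_image_le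
        exact_mod_cast ENat.toNat_le_of_le_coe (h1.trans (by exact_mod_cast h2))
    _ = ∑ v ∈ Lay, {ω' : BondConfig V | ∃ t ∈ top, ω' ∈ openConnIn U v t}.indicator
          (1 : BondConfig V → ℝ) ω := by
        rw [Finset.card_filter, Nat.cast_sum]
        refine Finset.sum_congr rfl fun v _ => ?_
        by_cases hv : W v
        · rw [if_pos hv, Set.indicator_of_mem
            (show ω ∈ {ω' : BondConfig V | ∃ t ∈ top, ω' ∈ openConnIn U v t} from hv),
            Pi.one_apply, Nat.cast_one]
        · rw [if_neg hv, Set.indicator_of_notMem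
            (show ω ∉ {ω' : BondConfig V | ∃ t ∈ top, ω' ∈ openConnIn U v t} from hv),
            Nat.cast_zero]

/-- The event "`v` is joined to `top` inside the finite region `U ⊇ top`" is measurable (a finite
union of the cylinder events `{v ↔ t in U}`). -/
theorem measurableSet_setOf_joined {U top : Set V} (hU : U.Finite) (htop : top ⊆ U) (v : V) :
    MeasurableSet {ω : BondConfig V | ∃ t ∈ top, ω ∈ openConnIn U v t} := by
  have hrw : {ω : BondConfig V | ∃ t ∈ top, ω ∈ openConnIn U v t} = ⋃ t ∈ top, openConnIn U v t := by
    ext ω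
    simp only [Set.mem_setOf_eq, Set.mem_iUnion, exists_prop]
  rw [hrw]
  refine MeasurableSet.biUnion (hU.subset htop).countable fun t _ => ?_
  rw [← hU.coe_toFinset]
  exact DCT16.measurableSet_openConnIn hU.toFinset v t

/-- **First moment of the level cutset**: under the hypotheses of
`toNat_minOpenCutIn_le_sum_indicator` (with `U` finite),
`E_p[MinCut_Q(bot, top)] ≤ Σ_{v ∈ Lay} P_p(v joined)` — the pointwise bound holds `P_p`-a.s.
(`ω ⊆ E(G)` a.s.) and the budget is nonnegative. -/
theorem integral_toNat_minOpenCutIn_le_sum [Countable V] {G : SimpleGraph V} (p : unitInterval)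
    {Q bot top U : Set V} {Lay : Finset V} (f : V → V) (hU : U.Finite)
    (hbot : ∀ x ∈ bot, x ∉ U) (htop : top ⊆ U)
    (hstep : ∀ a ∈ Q, a ∉ U → ∀ b ∈ U, G.Adj a b → a = f b ∧ b ∈ Lay) :
    ∫ ω, ((minOpenCutIn Q bot top ω).toNat : ℝ) ∂(bondPercolation G p) ≤
      ∑ v ∈ Lay, (bondPercolation G p).real
        {ω : BondConfig V | ∃ t ∈ top, ω ∈ openConnIn U v t} := by
  set μ := bondPercolation G p with hμ
  have hmeas : ∀ v, MeasurableSet {ω : BondConfig V | ∃ t ∈ top, ω ∈ openConnIn U v t} :=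
    fun v => measurableSet_setOf_joined hU htop v
  have hint : ∀ v, Integrable (fun ω => {ω' : BondConfig V | ∃ t ∈ top,
      ω' ∈ openConnIn U v t}.indicator (1 : BondConfig V → ℝ) ω) μ :=
    fun v => (integrable_const (1 : ℝ)).indicator (hmeas v)
  have hae : ∀ᵐ ω ∂μ, ((minOpenCutIn Q bot top ω).toNat : ℝ) ≤
      ∑ v ∈ Lay, {ω' : BondConfig V | ∃ t ∈ top, ω' ∈ openConnIn U v t}.indicator
        (1 : BondConfig V → ℝ) ω := by
    filter_upwards [(setBernoulli_ae_subset : ∀ᵐ ω ∂μ, ω ⊆ G.edgeSet)] with ω hω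
    exact toNat_minOpenCutIn_le_sum_indicator f hbot htop hstep hω
  calc ∫ ω, ((minOpenCutIn Q bot top ω).toNat : ℝ) ∂μ
      ≤ ∫ ω, ∑ v ∈ Lay, {ω' : BondConfig V | ∃ t ∈ top, ω' ∈ openConnIn U v t}.indicator
          (1 : BondConfig V → ℝ) ω ∂μ :=
        integral_mono_of_nonneg (Filter.Eventually.of_forall fun ω => Nat.cast_nonneg _)
          (integrable_finsetSum _ fun v _ => hint v) hae
    _ = ∑ v ∈ Lay, ∫ ω, {ω' : BondConfig V | ∃ t ∈ top, ω' ∈ openConnIn U v t}.indicator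
          (1 : BondConfig V → ℝ) ω ∂μ := integral_finsetSum _ fun v _ => hint v
    _ = ∑ v ∈ Lay, μ.real {ω : BondConfig V | ∃ t ∈ top, ω ∈ openConnIn U v t} :=
        Finset.sum_congr rfl fun v _ => integral_indicator_one (hmeas v)

end General

/-! ### Geometry of the slab piece `Q(L, N) = [0, L]² × [0, N]` -/

/-- Membership in a horizontal layer block `[0, L]² × [a, b] = Set.Icc ![0, 0, a] ![L, L, b]` of the
slab piece, coordinatewise (cf. `StubSixLids.mem_Icc3_iff` for general boxes). -/
theorem mem_layers_iff {L : ℕ} {a b : ℤ} {w : Site 3} :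
    w ∈ Set.Icc (![0, 0, a] : Site 3) ![(L : ℤ), (L : ℤ), b] ↔
      (0 ≤ w 0 ∧ w 0 ≤ L) ∧ (0 ≤ w 1 ∧ w 1 ≤ L) ∧ (a ≤ w 2 ∧ w 2 ≤ b) := by
  simp only [Set.mem_Icc, Pi.le_def, Fin.forall_fin_succ, IsEmpty.forall_iff, and_true,
    Matrix.cons_val_zero, Matrix.cons_val_succ, Fin.succ_zero_eq_one, Fin.succ_one_eq_two]
  tauto

/-- Membership in the finite layer block `Finset.Icc ![0, 0, a] ![L, L, b]`, coordinatewise. -/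
theorem mem_finsetLayers_iff {L : ℕ} {a b : ℤ} {w : Site 3} :
    w ∈ Finset.Icc (![0, 0, a] : Site 3) ![(L : ℤ), (L : ℤ), b] ↔
      (0 ≤ w 0 ∧ w 0 ≤ L) ∧ (0 ≤ w 1 ∧ w 1 ≤ L) ∧ (a ≤ w 2 ∧ w 2 ≤ b) := by
  rw [← Finset.mem_coe, Finset.coe_Icc, mem_layers_iff]

/-- A lattice neighbour `b` of `a` one level higher is `a + e₂`, i.e. `a = b - e₂`. -/
theorem eq_sub_single_of_adj {a b : Site 3} (hab : (zdGraph 3).Adj a b) (h2 : b 2 = a 2 + 1) :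
    a = b - Pi.single 2 1 := by
  obtain ⟨i, hi | hi⟩ := (zdGraph_adj_iff a b).1 hab
  · have hb : b 2 = a 2 + (Pi.single i (1 : ℤ) : Site 3) 2 := by rw [hi, Pi.add_apply]
    by_cases hi2 : i = 2
    · subst hi2
      rw [hi, add_sub_cancel_right]
    · rw [Pi.single_eq_of_ne' hi2] at hb
      omega
  · have ha : a 2 = b 2 + (Pi.single i (1 : ℤ) : Site 3) 2 := by rw [hi, Pi.add_apply]
    have h01 : (Pi.single i (1 : ℤ) : Site 3) 2 = 0 ∨ (Pi.single i (1 : ℤ) : Site 3) 2 = 1 := by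
      by_cases hi2 : i = 2
      · subst hi2
        right
        exact Pi.single_eq_same _ _
      · left
        exact Pi.single_eq_of_ne' hi2 _
    omega

/-- The layer `{z = 1}` of `Q(L, N)` has `(L+1)²` vertices. -/
theorem card_layer_le (L : ℕ) :
    ((Finset.Icc (![0, 0, 1] : Site 3) ![(L : ℤ), (L : ℤ), 1]).card : ℝ) ≤ ((L : ℝ) + 1) ^ 2 := by
  rw [Pi.card_Icc, Fin.prod_univ_three]
  simp only [Matrix.cons_val_zero, Matrix.cons_val_one, Matrix.cons_val_two, Matrix.head_cons,
    Matrix.tail_cons, Int.card_Icc]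
  have h1 : ((L : ℤ) + 1 - 0).toNat = L + 1 := by omega
  have h2 : ((1 : ℤ) + 1 - 1).toNat = 1 := by decide
  rw [h1, h2]
  push_cast
  nlinarith

/-! ### Symmetry: a joined vertex of layer `1` gives a half-space arm to distance `h` -/

/-- Transport by the face symmetry `g = faceIso v 2 1` (`v` on layer `1`): `g v = 0`,
`(g z)₀ = z₂ - 1`, so `g` maps `U ⊆ {1 ≤ z₂}` into `ℍ = {0 ≤ x₀}` and the top layer `{z₂ = h + 1}` to
`{x₀ = h}`; hence "`v` joined to top inside `U`" is carried into `armH h`. -/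
theorem setOf_joined_subset_preimage_armH {U top : Set (Site 3)} {v : Site 3} {h : ℕ}
    (hU : ∀ z ∈ U, 1 ≤ z 2) (htop2 : ∀ t ∈ top, t 2 = (h : ℤ) + 1) (hv2 : v 2 = 1) :
    {ω : BondConfig (Site 3) | ∃ t ∈ top, ω ∈ openConnIn U v t} ⊆
      BondConfig.relabel (sym2Equiv (faceIso v 2 1).toEquiv) ⁻¹' armH h := by
  rintro ω ⟨t, ht, hω⟩
  rw [Set.mem_preimage]
  have h1 := relabel_mem_openConnIn (faceIso v 2 1).toEquiv hω
  rw [faceIso_apply_self] at h1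
  refine ⟨(faceIso v 2 1).toEquiv t, ⟨0, ?_⟩, openConnIn_mono ?_ _ _ h1⟩
  · rw [faceIso_apply_zero, htop2 t ht, hv2, Units.val_one, one_mul]
    rw [le_abs]
    left
    omega
  · rintro _ ⟨z, hz, rfl⟩
    change 0 ≤ (faceIso v 2 1).toEquiv z 0
    rw [faceIso_apply_zero, hv2, Units.val_one, one_mul]
    have := hU z hz
    omega

/-- **Symmetry bound**: for `v` on layer `1`, `U ⊆ {1 ≤ z₂}` and `top ⊆ {z₂ = h + 1}`,
`P_p(v ↔ top in U) ≤ P_p(armH h)` (invariance of `P_p` under the lattice automorphism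
`faceIso v 2 1`, `bondPercolation_real_preimage_relabel_iso`). -/
theorem real_setOf_joined_le (p : unitInterval) {U top : Set (Site 3)} {v : Site 3} {h : ℕ}
    (hU : ∀ z ∈ U, 1 ≤ z 2) (htop2 : ∀ t ∈ top, t 2 = (h : ℤ) + 1) (hv2 : v 2 = 1) :
    (bondPercolation (zdGraph 3) p).real
        {ω : BondConfig (Site 3) | ∃ t ∈ top, ω ∈ openConnIn U v t} ≤
      (bondPercolation (zdGraph 3) p).real (armH h) := by
  rw [← bondPercolation_real_preimage_relabel_iso (faceIso v 2 1) p (armH h)]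
  exact measureReal_mono (setOf_joined_subset_preimage_armH hU htop2 hv2) (measure_ne_top _ _)

/-- **The ceiling for the slab piece** `Q(L, h+1)`:
`E_p[S(L, h+1)] ≤ (L+1)² · P_p(armH h)` (level cutset + first moment + symmetry + the layer count). -/
theorem integral_slabMinCut_le (p : unitInterval) (L h : ℕ) :
    ∫ ω, ((minOpenCutIn
        (Set.Icc (![0, 0, 0] : Site 3) ![(L : ℤ), (L : ℤ), ((h + 1 : ℕ) : ℤ)])
        (Set.Icc (![0, 0, 0] : Site 3) ![(L : ℤ), (L : ℤ), 0])
        (Set.Icc (![0, 0, ((h + 1 : ℕ) : ℤ)] : Site 3) ![(L : ℤ), (L : ℤ), ((h + 1 : ℕ) : ℤ)])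
        ω).toNat : ℝ) ∂(bondPercolation (zdGraph 3) p) ≤
      ((L : ℝ) + 1) ^ 2 * (bondPercolation (zdGraph 3) p).real (armH h) := by
  set μ := bondPercolation (zdGraph 3) p with hμ
  -- the upper region `U = Q ∩ {1 ≤ z}` and the layer `{z = 1}`
  set U : Set (Site 3) := Set.Icc (![0, 0, 1] : Site 3) ![(L : ℤ), (L : ℤ), ((h + 1 : ℕ) : ℤ)]
    with hUdef
  set Lay : Finset (Site 3) := Finset.Icc (![0, 0, 1] : Site 3) ![(L : ℤ), (L : ℤ), 1] with hLay
  have hbot : ∀ x ∈ Set.Icc (![0, 0, 0] : Site 3) ![(L : ℤ), (L : ℤ), 0], x ∉ U := by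
    intro x hx hxU
    rw [hUdef, mem_layers_iff] at hxU
    rw [mem_layers_iff] at hx
    omega
  have htop : Set.Icc (![0, 0, ((h + 1 : ℕ) : ℤ)] : Site 3) ![(L : ℤ), (L : ℤ), ((h + 1 : ℕ) : ℤ)]
      ⊆ U := by
    intro t ht
    rw [hUdef, mem_layers_iff]
    rw [mem_layers_iff] at ht
    omega
  have hstep : ∀ a ∈ Set.Icc (![0, 0, 0] : Site 3) ![(L : ℤ), (L : ℤ), ((h + 1 : ℕ) : ℤ)], a ∉ U →
      ∀ b ∈ U, (zdGraph 3).Adj a b → a = b - Pi.single 2 1 ∧ b ∈ Lay := by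
    intro a haQ haU b hbU hab
    rw [hUdef, mem_layers_iff] at haU hbU
    rw [mem_layers_iff] at haQ
    have h22 := DCT16.abs_sub_le_one_of_adj hab 2
    rw [abs_le] at h22
    have hb2 : b 2 = a 2 + 1 := by omega
    refine ⟨eq_sub_single_of_adj hab hb2, ?_⟩
    rw [hLay, mem_finsetLayers_iff]
    omega
  have hU1 : ∀ z ∈ U, 1 ≤ z 2 := by
    intro z hz
    rw [hUdef, mem_layers_iff] at hz
    exact hz.2.2.1
  have htop2 : ∀ t ∈ Set.Icc (![0, 0, ((h + 1 : ℕ) : ℤ)] : Site 3) ![(L : ℤ), (L : ℤ), ((h + 1 : ℕ) : ℤ)],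
      t 2 = (h : ℤ) + 1 := by
    intro t ht
    rw [mem_layers_iff] at ht
    push_cast at ht
    omega
  have hLay2 : ∀ v ∈ Lay, v 2 = 1 := by
    intro v hv
    rw [hLay, mem_finsetLayers_iff] at hv
    omega
  calc ∫ ω, ((minOpenCutIn
          (Set.Icc (![0, 0, 0] : Site 3) ![(L : ℤ), (L : ℤ), ((h + 1 : ℕ) : ℤ)])
          (Set.Icc (![0, 0, 0] : Site 3) ![(L : ℤ), (L : ℤ), 0])
          (Set.Icc (![0, 0, ((h + 1 : ℕ) : ℤ)] : Site 3) ![(L : ℤ), (L : ℤ), ((h + 1 : ℕ) : ℤ)])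
          ω).toNat : ℝ) ∂μ
      ≤ ∑ v ∈ Lay, μ.real {ω : BondConfig (Site 3) | ∃ t ∈
          Set.Icc (![0, 0, ((h + 1 : ℕ) : ℤ)] : Site 3) ![(L : ℤ), (L : ℤ), ((h + 1 : ℕ) : ℤ)],
            ω ∈ openConnIn U v t} :=
        integral_toNat_minOpenCutIn_le_sum p (fun b => b - Pi.single 2 1) (Set.finite_Icc _ _)
          hbot htop hstep
    _ ≤ ∑ _v ∈ Lay, μ.real (armH h) :=
        Finset.sum_le_sum fun v hv => real_setOf_joined_le p hU1 htop2 (hLay2 v hv)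
    _ = (Lay.card : ℝ) * μ.real (armH h) := by rw [Finset.sum_const, nsmul_eq_mul]
    _ ≤ ((L : ℝ) + 1) ^ 2 * μ.real (armH h) := by
        gcongr
        exact card_layer_le L

end StubCeiling

/-- **`stub_ceiling` (registered stub of line `Sketch`, crux stmt-CriticalPhenomena-5248): the level-cutset
ceiling** `E_p[S(L, h+1)] ≤ (L+1)² · P_p(armH h)` for every `p`, `L`, `h` (Zhang 2000 /
Rossignol–Théret 2018, Prop. 3.9, in slab form): on a lattice configuration the vertical edges
`s(v - e₂, v)`, `v` on the layer `{z = 1}` joined to the top layer inside `Q(L, h+1) ∩ {1 ≤ z}`, form an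
open bottom-to-top cutset of `Q(L, h+1)`; each of the `(L+1)²` indicators has probability at most
`P_p(armH h)` by the lattice symmetry taking `v` to `0` and the vertical axis to the `0`-th one. -/
theorem stub_ceiling :
    ∀ (p : unitInterval) (L h : ℕ),
      ∫ ω, ((minOpenCutIn
          (Set.Icc (![0, 0, 0] : Site 3) ![(L : ℤ), (L : ℤ), ((h + 1 : ℕ) : ℤ)])
          (Set.Icc (![0, 0, 0] : Site 3) ![(L : ℤ), (L : ℤ), 0])
          (Set.Icc (![0, 0, ((h + 1 : ℕ) : ℤ)] : Site 3) ![(L : ℤ), (L : ℤ), ((h + 1 : ℕ) : ℤ)])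
          ω).toNat : ℝ) ∂(bondPercolation (zdGraph 3) p) ≤
      ((L : ℝ) + 1) ^ 2 * (bondPercolation (zdGraph 3) p).real
        {ω | ∃ y : Site 3, (∃ i : Fin 3, (h : ℤ) ≤ |y i|) ∧
          ω ∈ openConnIn {x : Site 3 | 0 ≤ x 0} 0 y} :=
  fun p L h => StubCeiling.integral_slabMinCut_le p L h

end Summit.CriticalPhenomena.PercolationContinuityZ3.Theorems.BudgetTightness

end
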